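import Literature.Computability.QuantumComplexity.PPPostBQPCore
import Literature.Computability.QuantumComplexity.CWrapExpr
import HarnessLib

/-!
# `PP ⊆ PostBQP`, VII: the quantum core is polynomial-time uniform

Topic `Literature/Computability/QuantumComplexity`; seventh file of the series proving Aaronson's
`PP ⊆ PostBQP` (Proc. R. Soc. A 461 (2005), Thm. 4, whose Def. 1 asks for a *uniform* family:
"there exists a classical algorithm that outputs a description of `Cₙ` in time polynomial in
`n`"). The family `Core.family` of `PPPostBQPCore.lean` (Hadamards on the coin wires, the compiled
garbage-free block of the counting machine, Hadamards on the body wires and on the result zone)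
is polynomial-time uniform (`Core.family_isUniform`). The proof is the generator-program route of
the tree (`Cryptography/KitaevFamilyUniform.lean` is the model followed line by line): the
description `sigmaEncode ⟨n, anc n, circ n⟩` is the concatenation of three rendered token
streams —

* piece 1: the header `dbl (bin n) 01 1^{2 anc n} 01`, the first Hadamard layer, the suffix
  `NOT`s of `vg n`, the tableau forwards and the read-out (`gen1`);
* piece 2: the tableau backwards, generated back to front and reversed
  (`RevClean.render_reverse_out_mem_FP`);
* piece 3: the suffix `NOT`s again and the second Hadamard layer (`gen3`);

all sizes being counter expressions in the family index (`CWrap.polyE` for the coin polynomial,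
`RevSim.ancNE`, `RevClean.JJE` substituted at the tableau length `nT n`), so that
`GStmt.render_out_mem_FP` applies; the stream identity `desc_eq` is checked block by block.

## References

* S. Aaronson, *Quantum computing, postselection, and probabilistic polynomial-time*, Proc. R.
  Soc. A 461 (2005) 3473–3482, arXiv:quant-ph/0412187: Def. 1 (uniformity), Thm. 4.
* S. Arora, B. Barak, *Computational Complexity: A Modern Approach*, CUP 2009, §6.2 Def. 6.12 and
  proof of Thm. 6.15 (descriptions printed with counters), Remark 6.7.
-/

noncomputable section

namespace Literature.Computability.QuantumComplexity

namespace PPPostBQP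

namespace Core

open Complexity Cryptography RevDesc RevSim RevClean CWrap _root_.Computability

variable (Q : Core)

attribute [local simp] GExpr.eval

/-! ### The sizes as counter expressions -/

/-- `InUU` is closed under sums. [folklore] -/
theorem inUU_add {a b : GE} (ha : InUU a) (hb : InUU b) : InUU (.add a b) := fun x hx => by
  simp only [GExpr.fv, List.mem_append] at hx
  rcases hx with h | h
  exacts [ha x h, hb x h]

/-- `InUU` is closed under products. [folklore] -/
theorem inUU_mul {a b : GE} (ha : InUU a) (hb : InUU b) : InUU (.mul a b) := fun x hx => by
  simp only [GExpr.fv, List.mem_append] at hx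
  rcases hx with h | h
  exacts [ha x h, hb x h]

/-- The family index is `InUU`. [folklore] -/
theorem inUU_var : InUU (.var .uu : GE) := fun x hx => by simpa [GExpr.fv] using hx

/-- Constants are `InUU`. [folklore] -/
theorem inUU_const (c : ℕ) : InUU (.const c : GE) := fun x hx => by simp [GExpr.fv] at hx

/-- `m = p(uu)`. [folklore] -/
def pE : GE := polyE Q.p (.var .uu)
/-- `K = m + 2`. [folklore] -/
def KE : GE := .add Q.pE (.const 2)
/-- `B = (m + 3) + ((m + 1) + 1)`. [folklore] -/
def BdE : GE := .add (.add Q.pE (.const 3)) (.add (.add Q.pE (.const 1)) (.const 1))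
/-- `bods = K · B`. [folklore] -/
def bodsE : GE := .mul Q.KE Q.BdE
/-- `ρ = K + bods`. [folklore] -/
def rhoE : GE := .add Q.KE Q.bodsE
/-- `n0 = uu + ρ`. [folklore] -/
def n0E : GE := .add (.var .uu) Q.rhoE
/-- the tableau length `nT = n0 + (2 uu + 2)` [folklore] -/
def NTE : GE := .add Q.n0E (.add (.mul (.const 2) (.var .uu)) (.const 2))
/-- the ancilla count `anc = ρ + (2 uu + 2) + ancN (nT) + JJ (nT) · A₁` [folklore] -/
def ancE : GE := .add (.add Q.rhoE (.add (.mul (.const 2) (.var .uu)) (.const 2)))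
  (.add ((ancNE Q.M.tm Q.e).subst (substN Q.NTE)) (.mul ((JJE Q.e Q.M).subst (substN Q.NTE)) (.const (A₁ Q.M))))
/-- the start of the result zone `NN (nT) = nT + ancN (nT)` [folklore] -/
def resStartE : GE := .add Q.NTE ((ancNE Q.M.tm Q.e).subst (substN Q.NTE))
/-- the length of the result zone `K · A₁` [folklore] -/
def resLenE : GE := .mul Q.KE (.const (A₁ Q.M))

variable (env : GV → ℕ)

/-- value of `pE` [folklore] -/
@[simp] theorem eval_pE : Q.pE.eval env = Q.p.eval (env .uu) := by simp [pE]
/-- value of `KE` [folklore] -/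
@[simp] theorem eval_KE : Q.KE.eval env = Q.K (env .uu) := by simp [KE, K]
/-- value of `BdE` [folklore] -/
@[simp] theorem eval_BdE : Q.BdE.eval env = bodyLen Q.p (env .uu) := by simp [BdE, bodyLen]
/-- value of `bodsE` [folklore] -/
@[simp] theorem eval_bodsE : Q.bodsE.eval env = Q.bods (env .uu) := by simp [bodsE, bods, bodiesLen_eq, Nat.mul_comm]
/-- value of `rhoE` [folklore] -/
@[simp] theorem eval_rhoE : Q.rhoE.eval env = Q.rho (env .uu) := by simp [rhoE, rho]
/-- value of `n0E` [folklore] -/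
@[simp] theorem eval_n0E : Q.n0E.eval env = Q.n0 (env .uu) := by simp [n0E, n0]
/-- value of `NTE` [folklore] -/
@[simp] theorem eval_NTE : Q.NTE.eval env = Q.nT (env .uu) := by simp [NTE, nT, length_vg]

/-- `NN = n + ancN n`. [folklore] -/
theorem NN_eq_add_ancN (n : ℕ) : NN Q.e Q.M n = n + ancN Q.M.tm Q.e n := by
  rw [NN_eq]; unfold ansW ancN LB; ring

/-- The total width in closed form. [folklore] -/
theorem W_eq (n : ℕ) : Q.W n = Q.nT n + ancN Q.M.tm Q.e (Q.nT n) + JJ Q.e Q.M (Q.nT n) * A₁ Q.M := by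
  unfold W width copyN; rw [NN_eq_add_ancN]

/-- value of `ancE`: the ancilla count [folklore] -/
@[simp] theorem eval_ancE : Q.ancE.eval env = Q.anc (env .uu) := by
  have h := Q.W_eq (env .uu)
  unfold anc
  rw [h]
  simp only [ancE, GExpr.eval, GExpr.eval_subst, eval_substN, eval_rhoE, eval_NTE, eval_ancNE, eval_JJE,
    Function.update_self]
  unfold nT n0
  rw [length_vg]
  omega

/-- value of `resStartE` [folklore] -/
@[simp] theorem eval_resStartE : Q.resStartE.eval env = Q.resStart (env .uu) := by
  unfold resStart; rw [NN_eq_add_ancN]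
  simp only [resStartE, GExpr.eval, GExpr.eval_subst, eval_substN, eval_NTE, eval_ancNE, Function.update_self]

/-- value of `resLenE` [folklore] -/
@[simp] theorem eval_resLenE : Q.resLenE.eval env = Q.resLen (env .uu) := by simp [resLenE, resLen]

/-- `pE` mentions the family index only. [folklore] -/
theorem inUU_pE : InUU Q.pE := fun x hx => by
  have := fv_polyE_sub Q.p (.var .uu) x hx
  simpa [GExpr.fv] using this

/-- `KE` mentions the family index only. [folklore] -/
theorem inUU_KE : InUU Q.KE := inUU_add Q.inUU_pE (inUU_const _)

/-- `rhoE` mentions the family index only. [folklore] -/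
theorem inUU_rhoE : InUU Q.rhoE :=
  inUU_add Q.inUU_KE (inUU_mul Q.inUU_KE (inUU_add (inUU_add Q.inUU_pE (inUU_const _))
    (inUU_add (inUU_add Q.inUU_pE (inUU_const _)) (inUU_const _))))

/-- `n0E` mentions the family index only. [folklore] -/
theorem inUU_n0E : InUU Q.n0E := inUU_add inUU_var Q.inUU_rhoE

/-- `NTE` mentions the family index only. [folklore] -/
theorem inUU_NTE : InUU Q.NTE := inUU_add Q.inUU_n0E (inUU_add (inUU_mul (inUU_const _) inUU_var) (inUU_const _))

/-! ### The generators -/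

/-- The abstract `H` gate on wire `w` (a description record; the same as `ModExpBlock.agH` of
`Cryptography/KitaevFamilyUniform.lean`, re-declared to keep that file's Shor-specific import
closure out of this one). [folklore] -/
def hRec (w : ℕ) : AGate ℕ := ⟨.H, [w]⟩

/-- Bits of the abstract `H` gate. [folklore] -/
@[simp] theorem bits_hRec (w : ℕ) : (hRec w).bits = gateBits 0 1 [w] := by simp [hRec, AGate.bits, symCode, symArity]

/-- **the header** `dbl (bin n) 01 1^{2 anc} 01` [folklore] -/
def headerG : GS :=
  .seq (ticksG (.var .uu)) (.seq (.emit (Tok.dump false true :: litT [false, true]))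
    (.seq (.loop .jj (.mul (.const 2) Q.ancE) (.emit [Tok.lit true])) (.emit (litT [false, true]))))

/-- **the first Hadamard layer**: one `H` on each coin wire `uu + j`, `j < ρ` [cite: Aaronson2005, Thm. 4 (proof: the uniform superposition)] -/
def hLayer1G : GS := .loop .jj Q.rhoE (agateG ⟨.H, [.add (.var .uu) (.var .jj)]⟩)

/-- **the second Hadamard layer**: the body wires `uu + K + j`, `j < bods`, then the result zone
`resStart + j`, `j < K · A₁` [cite: Aaronson2005, Thm. 4 (proof: Hadamards on the first register)] -/
def hLayer2G : GS :=
  .seq (.loop .jj Q.bodsE (agateG ⟨.H, [.add (.add (.var .uu) Q.KE) (.var .jj)]⟩))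
    (.loop .jj Q.resLenE (agateG ⟨.H, [.add Q.resStartE (.var .jj)]⟩))

/-- the suffix runs of `vg n = 1 0 1^{2n}`: one `NOT` at `n0`, `2n` `NOT`s from `n0 + 2` [folklore] -/
def segs : List (GE × GE) := [(Q.n0E, .const 1), (.add Q.n0E (.const 2), .mul (.const 2) (.var .uu))]

/-- the suffix `NOT`s [folklore] -/
def notsG : GS := notsSegG Q.segs

/-- **Piece 1**: header, first Hadamard layer, suffix `NOT`s, the tableau forwards, the read-out. [folklore] -/
def gen1 : GS := seqs [Q.headerG, Q.hLayer1G, Q.notsG, compGW Q.e Q.M opsG Q.NTE, outGW Q.e Q.M opsG Q.NTE]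

/-- **Piece 2**: the tableau backwards, as a reversed token stream. [folklore] -/
def gen2 : GS := compGW Q.e Q.M opsGR Q.NTE

/-- **Piece 3**: suffix `NOT`s, the second Hadamard layer. [folklore] -/
def gen3 : GS := seqs [Q.notsG, Q.hLayer2G]

/-! ### Their streams -/

/-- The header stream. [folklore] -/
theorem out_headerG : Q.headerG.out env = headerToks (env .uu) (Q.anc (env .uu)) := by
  simp [headerG, GStmt.out, headerToks, flatMap_range_const]

/-- The first Hadamard-layer stream. [folklore] -/
theorem out_hLayer1G : Q.hLayer1G.out env =
    ((List.range (Q.rho (env .uu))).map fun j => hRec (env .uu + j)).flatMap AGate.toks := by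
  simp [hLayer1G, GStmt.out, List.flatMap_map, hRec, AGate.map]

/-- The abstract second layer. [folklore] -/
def h2Recs (n : ℕ) : List (AGate ℕ) :=
  ((List.range (Q.bods n)).map fun j => hRec (n + Q.K n + j)) ++
    ((List.range (Q.resLen n)).map fun j => hRec (Q.resStart n + j))

/-- The second Hadamard-layer stream. [folklore] -/
theorem out_hLayer2G : Q.hLayer2G.out env = (Q.h2Recs (env .uu)).flatMap AGate.toks := by
  simp [hLayer2G, GStmt.out, List.flatMap_map, hRec, AGate.map, h2Recs, List.flatMap_append]

/-- The suffix gadget of the block: one `NOT` at `n0`, and `2n` `NOT`s from `n0 + 2`. [folklore] -/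
theorem notsV_n0_vg (n : ℕ) :
    notsV (Q.n0 n) (vg n) = [ClOp.not (Q.n0 n + 0)] ++ (List.range (2 * n)).map fun i => ClOp.not (Q.n0 n + 2 + i) := by
  rw [vg, show ([true, false] : List Bool) = [true] ++ [false] from rfl, List.append_assoc, notsV_append, notsV_append,
    show ([true] : List Bool) = List.replicate 1 true from rfl, notsV_replicate_true, notsV_singleton_false,
    notsV_replicate_true]
  simp

/-- The suffix-`NOT` stream. [folklore] -/
theorem out_notsG : Q.notsG.out env = (notsV (Q.n0 (env .uu)) (vg (env .uu))).flatMap opToks := by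
  rw [notsG, out_notsSegG _ (fun p hp => by
    simp only [segs, List.mem_cons, List.not_mem_nil, or_false] at hp
    rcases hp with rfl | rfl
    · exact fun h => absurd (Q.inUU_n0E _ h) (by decide)
    · intro h
      simp only [GExpr.fv, List.mem_append, List.not_mem_nil, or_false] at h
      exact absurd (Q.inUU_n0E _ h) (by decide))]
  rw [notsV_n0_vg]
  simp [segs]

/-! ### Hygiene of the generators -/

/-- The loop variables of piece 1 are `tt`, `jj`, `ii`. [folklore] -/
theorem lv_gen1 : ∀ i ∈ Q.gen1.loopVars, i = GV.tt ∨ i = GV.jj ∨ i = GV.ii := by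
  intro i hi
  simp only [gen1, loopVars_seqs, List.flatMap_cons, List.flatMap_nil, List.append_nil, List.mem_append] at hi
  rcases hi with hi | hi | hi | hi | hi
  · simp [headerG, GStmt.loopVars, ticksG] at hi
    rcases hi with rfl | rfl <;> simp
  · simp [hLayer1G, GStmt.loopVars, agateG, seqs, wireG, ticksG] at hi
    rcases hi with rfl | rfl <;> simp
  · exact loopVars_notsSegG_sub _ i hi
  · exact loopVars_compGW_sub loopVars_opsG_sub _ i hi
  · exact loopVars_outGW_sub loopVars_opsG_sub _ i hi

/-- The family index is not a loop variable of piece 1. [folklore] -/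
theorem uu_not_mem_loopVars_gen1 : GV.uu ∉ Q.gen1.loopVars := fun h => by
  rcases Q.lv_gen1 _ h with h | h | h <;> exact absurd h (by decide)

/-- The family index is not a loop variable of piece 2. [folklore] -/
theorem uu_not_mem_loopVars_gen2 : GV.uu ∉ Q.gen2.loopVars := fun h => by
  rcases loopVars_compGW_sub loopVars_opsGR_sub _ _ h with h | h | h <;> exact absurd h (by decide)

/-- The family index is not a loop variable of piece 3. [folklore] -/
theorem uu_not_mem_loopVars_gen3 : GV.uu ∉ Q.gen3.loopVars := fun h => by
  simp only [gen3, loopVars_seqs, List.flatMap_cons, List.flatMap_nil, List.append_nil, List.mem_append] at h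
  rcases h with h | h
  · rcases loopVars_notsSegG_sub _ _ h with h | h | h <;> exact absurd h (by decide)
  · simp [hLayer2G, GStmt.loopVars, agateG, seqs, wireG, ticksG] at h

/-- Piece 1 reuses no loop variable. [folklore] -/
theorem noReuse_gen1 : Q.gen1.noReuse = true :=
  noReuse_seqs _ fun s hs => by
    simp only [List.mem_cons, List.not_mem_nil, or_false] at hs
    rcases hs with rfl | rfl | rfl | rfl | rfl
    · rfl
    · rfl
    · exact noReuse_notsSegG _
    · exact noReuse_compGW loopVars_opsG_sub noReuse_opsG _
    · exact noReuse_outGW loopVars_opsG_sub noReuse_opsG _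

/-- Piece 2 reuses no loop variable. [folklore] -/
theorem noReuse_gen2 : Q.gen2.noReuse = true := noReuse_compGW loopVars_opsGR_sub noReuse_opsGR _

/-- Piece 3 reuses no loop variable. [folklore] -/
theorem noReuse_gen3 : Q.gen3.noReuse = true :=
  noReuse_seqs _ fun s hs => by
    simp only [List.mem_cons, List.not_mem_nil, or_false] at hs
    rcases hs with rfl | rfl
    · exact noReuse_notsSegG _
    · rfl

/-! ### The description and its pieces -/

/-- Piece 1 rendered. [folklore] -/
def piece1 (z : List Bool) : List Bool := Tok.render 0 (Q.gen1.out (GenProg.initEnv .uu z.length))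
/-- Piece 2 rendered after reversal. [folklore] -/
def piece2 (z : List Bool) : List Bool := Tok.render 0 (Q.gen2.out (GenProg.initEnv .uu z.length)).reverse
/-- Piece 3 rendered. [folklore] -/
def piece3 (z : List Bool) : List Bool := Tok.render 0 (Q.gen3.out (GenProg.initEnv .uu z.length))

/-- **The description of the core family as a string function of `1ⁿ`.** [folklore] -/
def desc (z : List Bool) : List Bool := Q.piece1 z ++ (Q.piece2 z ++ Q.piece3 z)

/-- **`desc ∈ FP`** (`GStmt.render_out_mem_FP`, `render_reverse_out_mem_FP`, `append_mem_FP`).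
[cite: AroraBarak2009, §6.2 (Def. 6.12, proof of Thm. 6.15)] -/
theorem desc_mem_FP : Q.desc ∈ FP :=
  QuantumComplexity.append_mem_FP (GStmt.render_out_mem_FP Q.gen1 .uu Q.uu_not_mem_loopVars_gen1 Q.noReuse_gen1)
    (QuantumComplexity.append_mem_FP (render_reverse_out_mem_FP Q.gen2 .uu Q.uu_not_mem_loopVars_gen2 Q.noReuse_gen2)
      (GStmt.render_out_mem_FP Q.gen3 .uu Q.uu_not_mem_loopVars_gen3 Q.noReuse_gen3))

/-! ### The layers of the circuit as bit streams -/

/-- The first-layer bits. [folklore] -/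
def hBits1 (n : ℕ) : List Bool := ((List.range (Q.rho n)).map fun j => hRec (n + j)).flatMap AGate.bits

/-- The second-layer bits. [folklore] -/
def hBits2 (n : ℕ) : List Bool := (Q.h2Recs n).flatMap AGate.bits

/-- **The first Hadamard layer describes as the bits of its abstract gates.** [folklore] -/
theorem flatMap_gateEnc_hGates1 (n : ℕ) : (hGates (Q.coinWires n)).flatMap gateEnc = Q.hBits1 n := by
  rw [hGates, coinWires, hBits1]
  simp only [List.flatMap_map]
  refine List.flatMap_congr fun j hj => ?_
  rw [List.mem_range] at hj
  simp [gateEnc_hOn, Q.val_wire (Q.coin_lt hj)]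

/-- **The second Hadamard layer describes as the bits of its abstract gates.** [folklore] -/
theorem flatMap_gateEnc_hGates2 (n : ℕ) : (hGates (Q.h2Wires n)).flatMap gateEnc = Q.hBits2 n := by
  have hb : ∀ j, j < Q.bods n → n + Q.K n + j < n + Q.anc n := fun j hj => by
    have := Q.coin_lt (n := n) (j := Q.K n + j) (by unfold rho; omega); omega
  rw [hGates, h2Wires, bodyWires, resWires, hBits2, h2Recs]
  simp only [List.map_append, List.flatMap_append, List.flatMap_map]
  congr 1
  · refine List.flatMap_congr fun j hj => ?_
    rw [List.mem_range] at hj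
    simp [gateEnc_hOn, Q.val_wire (hb j hj)]
  · refine List.flatMap_congr fun j hj => ?_
    rw [List.mem_range] at hj
    simp [gateEnc_hOn, Q.val_wire (Q.res_lt hj)]

/-- **The block describes as the `opBits` of the clean program.** [folklore] -/
theorem flatMap_gateEnc_clamp (n : ℕ) : (revCompile (Q.clamp n)).flatMap gateEnc = (Q.prog n).flatMap opBits :=
  flatMap_gateEnc_revCompile_toRevList (Q.W_pos n) (Q.prog n) (Q.prog_lt n) _

/-- **The description of the `n`-th circuit of the core family**, block by block. [folklore] -/
theorem sigmaEncode_family (n : ℕ) :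
    QCircuit.sigmaEncode (G := cliffordT) ⟨n, Q.family.ancillas n, Q.family.circ n⟩ =
      SProg.dbl (encodeNat n) ++ [false, true] ++ (List.replicate (2 * Q.anc n) true ++ [false, true]) ++
        (Q.hBits1 n ++ ((notsV (Q.n0 n) (vg n)).flatMap opBits ++ ((comp Q.e Q.M (Q.nT n)).flatMap opBits ++
          ((outOps Q.e Q.M (Q.nT n)).flatMap opBits ++ ((comp Q.e Q.M (Q.nT n)).reverse.flatMap opBits ++
            ((notsV (Q.n0 n) (vg n)).flatMap opBits ++ Q.hBits2 n)))))) := by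
  change boolPair (encodeNat n) (boolPair (unaryEncodeNat (Q.anc n)) (QCircuit.encode (Q.circ n))) = _
  rw [circ, encode_eq_flatMap, List.flatMap_append, List.flatMap_append, flatMap_gateEnc_hGates1,
    flatMap_gateEnc_hGates2, flatMap_gateEnc_clamp, prog, cleanOps, show Q.n0 n + (vg n).length = Q.nT n from rfl,
    RevDesc.boolPair_eq, RevDesc.boolPair_eq, RevDesc.unaryEncodeNat_eq_replicate, dbl_replicate]
  simp only [List.flatMap_append, List.append_assoc]

/-- The input variable of the generators holds `n`. [folklore] -/
theorem initEnv_uu (n : ℕ) : GenProg.initEnv GV.uu n GV.uu = n := by simp [GenProg.initEnv]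

/-- **The stream of piece 1.** [folklore] -/
theorem out_gen1 (n : ℕ) : Q.gen1.out (GenProg.initEnv .uu n) =
    headerToks n (Q.anc n) ++ ((((List.range (Q.rho n)).map fun j => hRec (n + j)).flatMap AGate.toks) ++
      ((notsV (Q.n0 n) (vg n)).flatMap opToks ++ ((comp Q.e Q.M (Q.nT n)).flatMap opToks ++
        ((outOps Q.e Q.M (Q.nT n)).flatMap opToks ++ [])))) := by
  simp only [gen1, out_seqs, List.flatMap_cons, List.flatMap_nil, out_headerG, out_hLayer1G, out_notsG,
    out_compG Q.inUU_NTE, out_outGW opToks (fun ops env => out_opsG ops env) loopVars_opsG_sub Q.inUU_NTE, eval_NTE,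
    initEnv_uu]

/-- **The stream of piece 3.** [folklore] -/
theorem out_gen3 (n : ℕ) : Q.gen3.out (GenProg.initEnv .uu n) =
    (notsV (Q.n0 n) (vg n)).flatMap opToks ++ ((Q.h2Recs n).flatMap AGate.toks ++ []) := by
  simp only [gen3, out_seqs, List.flatMap_cons, List.flatMap_nil, out_notsG, out_hLayer2G, initEnv_uu]

/-- **Piece 1 rendered.** [folklore] -/
theorem piece1_eq (z : List Bool) : Q.piece1 z =
    SProg.dbl (encodeNat z.length) ++ [false, true] ++ (List.replicate (2 * Q.anc z.length) true ++ [false, true]) ++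
      (Q.hBits1 z.length ++ ((notsV (Q.n0 z.length) (vg z.length)).flatMap opBits ++
        ((comp Q.e Q.M (Q.nT z.length)).flatMap opBits ++ (outOps Q.e Q.M (Q.nT z.length)).flatMap opBits))) := by
  rw [piece1, out_gen1, render_headerToks, render_flatMap_toks, render_flatMap_opToks, render_flatMap_opToks,
    render_flatMap_opToks, Tok.render_nil, List.append_nil, hBits1]

/-- **Piece 2 rendered.** [folklore] -/
theorem piece2_eq (z : List Bool) : Q.piece2 z = (comp Q.e Q.M (Q.nT z.length)).reverse.flatMap opBits := by
  rw [piece2, gen2, reverse_out_compGR Q.inUU_NTE, eval_NTE, initEnv_uu,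
    ← List.append_nil ((comp Q.e Q.M (Q.nT z.length)).reverse.flatMap opToks),
    render_flatMap_opToks, Tok.render_nil, List.append_nil]

/-- **Piece 3 rendered.** [folklore] -/
theorem piece3_eq (z : List Bool) : Q.piece3 z =
    (notsV (Q.n0 z.length) (vg z.length)).flatMap opBits ++ Q.hBits2 z.length := by
  rw [piece3, out_gen3, render_flatMap_opToks, render_flatMap_toks, Tok.render_nil, List.append_nil, hBits2]

/-- **The stream identity**: the three rendered pieces are the description of the core family.
[cite: AroraBarak2009, §6.2 (proof of Thm. 6.15: descriptions printed with counters)] -/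
theorem desc_eq (z : List Bool) :
    Q.desc z = QCircuit.sigmaEncode (G := cliffordT) ⟨z.length, Q.family.ancillas z.length, Q.family.circ z.length⟩ := by
  rw [desc, piece1_eq, piece2_eq, piece3_eq, sigmaEncode_family]
  simp only [List.append_assoc]

/-! ### Uniformity -/

/-- **The quantum core family is polynomial-time uniform.** [cite: Aaronson2005, Def. 1 (uniform: a classical algorithm outputs a description of Cₙ in poly time)] -/
theorem family_isUniform : Q.family.IsUniform := by
  refine QCircuitFamily.isUniform_of_mem_FP _ ?_
  have h := Q.desc_mem_FP
  rw [show Q.desc = fun z => QCircuit.sigmaEncode (G := cliffordT)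
    ⟨z.length, Q.family.ancillas z.length, Q.family.circ z.length⟩ from funext Q.desc_eq] at h
  exact h

end Core

end PPPostBQP

end Literature.Computability.QuantumComplexity

end
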